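import Summits.ValiantsHypothesis.ValiantsHypothesis.Theorems.BIPWhatWouldSuffice
import Literature.Computability.AlgebraicComplexity.BIPPaddingDegenerations
import Literature.Computability.AlgebraicComplexity.HwvIdealRankBound
import Literature.Computability.AlgebraicComplexity.MS08Obstructions
import Literature.Computability.AlgebraicComplexity.OrbitMultiplicitySemigroup
import Literature.Computability.AlgebraicComplexity.MultiplicityObstructionsProofs
import Literature.NumberTheory.DiophantineGeometry.SchurWeylPlethysmRenameProofs
import Literature.Barriers.ValiantsHypothesis.IP17RectangularKronecker
import Literature.Computability.AlgebraicComplexity.GCTObstructionsWeightForm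
import Literature.Computability.Complexity.OccurrenceObstructionsModuleForm
import Literature.Computability.AlgebraicComplexity.DIP20MultiplicityObstructions
import HarnessLib

/-!
# BIP corpus — «what would suffice» chain for rung V3, part 2: over the TYPED sections

Continuation of `Theorems/BIPWhatWouldSuffice.lean` (links (a)–(f), val-lit cell, D-0074 GROUP L) over
the sections of the BIP corpus typed in this wave: Mulmuley–Sohoni GCT II §1 (`MS08Obstructions.lean`),
Ikenmeyer–Panova 2017 §1(a) (`Literature/Barriers/ValiantsHypothesis/IP17RectangularKronecker.lean`),
Bürgisser–Ikenmeyer–Panova 2019 §1(a) padding (`BIPPaddingDegenerations.lean`), and the tree's HWV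
engines for the Dörfler–Ikenmeyer–Panova 2020 §5 two-sided method (`HwvIdealRankBound.lean`,
`OrbitMultiplicitySemigroup.lean`).

Honest framing (as in part 1). `VP ≠ VNP` is NOT proved here or anywhere in the tree. Every theorem
below is a sorry-free composition of tree theorems whose OPEN link is a hypothesis binder and whose
conclusion is the EXISTING rung `Summit.PneNP.GCT.MultObstructionPer3Det4` (item
stmt-ValiantsHypothesis-19612) — or, for link (m), the separation `¬ HasBorderDetRepr ℂ 3 4` that the
rung validates against (KNOWN: `dc̄(per₃) = 5`, Landsberg–Manivel–Ressayre 2013; the rung is method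
validation, not a new lower bound). No new conjecture, no named fact, no axiom. The FAMILY versions of
links (n)/(p) are refuted resp. excluded in print and in the tree (`not_kroneckerVanishingRouteQP`,
`GCTOccurrenceObstructions_holds`); they are alive at `(3, 4)` only because `4 ≤ 3·3⁴` and `4 < 3^25`
(`kroneckerVanishing_not_excluded_at_rung`, part 1's `multObstructionPer3Det4_outside_bip_range`).
Nothing here is evidence that any hypothesis holds.

What the typed sections contribute, as links:

* GCT II Def. 1.3 / Thm. 1.8(a) (typer t02, `HasStrongObstruction`,
  `HasStrongObstruction.not_mem_orbitClosure`): a STRONG obstruction for `(X₀₀ per₃, det₄)` gives the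
  separation directly — link (m). APPEND (2026-08-26, after `OccurrenceObstructionWeights.lean`
  landed the intertwiner→weight bridge `exists_isOccurrenceObstructionAt_of_hasOccurrenceObstruction`,
  module form ⇒ numeric form, on top of `not_hasOccurrenceObstruction_of_forall_hasHighestWeight`):
  a module-form OCCURRENCE obstruction, and hence a strong obstruction, for `(X₀₀ per₃, det₄)` now
  reaches the RUNG itself — links (m″) `multObstructionPer3Det4_of_hasOccurrenceObstruction`,
  (m‴) `multObstructionPer3Det4_of_strongObstruction` (lexicographic variables) and
  (m⁗) `multObstructionPer3Det4_of_strongObstruction_matrix` (G20's `Fin 4 × Fin 4` variables, the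
  hypothesis of (m) verbatim). The first landing's remark that this bridge "is not in the tree" was
  wrong: the weight-form ⇒ module-form direction was already proved in `GCTObstructionsWeightForm.lean`.
  The MULTIPLICITY analogue (`HasMultiplicityObstruction` ⇒ some `IsMultiplicityObstructionAt`, isotypic
  counting) is not proved and not used.
* IP 2017 §1(a): printed Thm. 1.4 (TeX `thm:strategy`; e-print and tree label "Thm. 1.3",
  `ikenmeyerPanova2017_thm_1_3`) is part 1's link (b); (1.5), the Kronecker-VANISHING occurrence form,
  typed by t05 as the technique class `KroneckerVanishingObstructionAt` (IP's = BIP's padding) and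
  `FreshKroneckerVanishingObstructionAt` (the rung's padding): links (n), (n′). Printed Thm. 1.6 (Main
  Theorem; e-print/tree "Thm. 1.4") refutes them only for `m > 3n⁴`.
* BIP 2019 §1(a), the padding dictionary: `Z_{n,m}` pads with a variable OF the permanent, the rung
  with a fresh one, and `X₁₁^{m-n} per_n ∈ Δ(X₀₀^{m-n} per_n)` (`bipPaddedPerPoly_mem_orbitClosure_paddedPerPoly`,
  PROVED), so per-side occurrence/multiplicity in BIP's module language transfers to the rung
  (`orbitMultiplicity_bipPadded_le_padded`): link (p), and the per side of (n).
* DIP 2020 §5 / IK 2020: the two-sided comparison with explicit highest-weight vectors — links (g)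
  (det side discharged by a symmetric-Kronecker NUMBER, BLMW (5.2.7)) and (h) (det side discharged by
  EXHIBITED det₄-ideal highest-weight vectors, rank–nullity). Remark (no theorem here, to keep this
  file independent of a module still being extended): DIP's numerical set-form multiplicity
  `mult_λ ℂ[Z̄]` (`coordRingMultiplicity`, `DIP20MultiplicityObstructions.lean`, typer t07) equals
  `orbitMultiplicity` on any set squeezed between an orbit and its endomorphism orbit
  (`coordRingMultiplicity_eq_orbitMultiplicity`), so a DIP (2.2)-style strict inequality between the
  `det₄` and `X₀₀ per₃` sides at one weight is literally `MultObstructionPer3Det4` (`multObstructionPer3Det4_iff`).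

## Main results (all elementary compositions of tree theorems; every hypothesis OPEN)
* `multObstructionPer3Det4_of_cert_sk` (g), `multObstructionPer3Det4_of_cert_idealHwv` (h).
* `bipPaddedPerFormLex_mem_orbitClosure_paddedPerFormLex`, `orbitMultiplicity_bipPadded_le_padded`
  (padding, PROVED outright), `perDetMultiplicityObstruction_of_bipOccurrence`,
  `exists_perDetMultiplicityObstruction_of_kroneckerVanishing` (general `n ≤ m`),
  `multObstructionPer3Det4_of_bipOccurrence` (p), `multObstructionPer3Det4_of_kroneckerVanishing` (n),
  `multObstructionPer3Det4_of_freshKroneckerVanishing` (n′), `kroneckerVanishing_not_excluded_at_rung`.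
* `not_hasBorderDetRepr_three_four_of_strongObstruction` (m); APPENDED: `multObstructionPer3Det4_of_hasOccurrenceObstruction` (m″),
  `multObstructionPer3Det4_of_strongObstruction` (m‴), `multObstructionPer3Det4_of_strongObstruction_matrix` (m⁗).
* APPENDED (set form): `multObstructionPer3Det4_of_coordRingMultiplicity_lt` (q),
  `multObstructionPer3Det4_of_coordRingMultiplicity_glOrbit_lt` (q′).

## References
* K. Mulmuley, M. Sohoni, *GCT II*, arXiv:cs/0612134 = SIAM J. Comput. 38 (2008), Def. 1.3, Thm. 1.8(a).
* P. Bürgisser, J. M. Landsberg, L. Manivel, J. Weyman, SIAM J. Comput. 40 (2011) = arXiv:0907.2850,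
  §5.2 (5.2.7).
* C. Ikenmeyer, G. Panova, Adv. Math. 319 (2017) = arXiv:1512.03798, §1(a): (1.5), printed Thm. 1.4
  (e-print Thm. 1.3), printed Thm. 1.6 (e-print Thm. 1.4); §7 (the two paddings).
* P. Bürgisser, C. Ikenmeyer, G. Panova, J. AMS 32 (2019) = arXiv:1604.06431, Thm. 1.4, §1(a), Lemma 2.2.
* J. Dörfler, C. Ikenmeyer, G. Panova, SIAM J. Appl. Algebra Geom. 4 (2020) = arXiv:1901.04576, §2
  (2.2), §5 (5.3)–(5.4).
* C. Ikenmeyer, U. Kandasamy, STOC 2020 = arXiv:1911.03990, Thm. 4.2.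
* J. M. Landsberg, L. Manivel, N. Ressayre, Comment. Math. Helv. 88 (2013), Thm. 1.0.3.
-/

noncomputable section

namespace Summit.ValiantsHypothesis.BIPWhatWouldSufficeTyped

open Literature.Computability.AlgebraicComplexity Literature.NumberTheory.DiophantineGeometry
open Literature.Computability.Complexity (bipPaddedPerFormLex bipPaddedPerOrbitRep partitionWeightLex
  bipPaddedPerFormLex_isHomogeneous)
open Literature.Barriers.ValiantsHypothesis (KroneckerVanishingObstructionAt
  FreshKroneckerVanishingObstructionAt
  freshKroneckerVanishingObstructionAt_iff_exists_perDetKroneckerObstructionAt)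
open Summit.PneNP.GCT Summit.ValiantsHypothesis.BIPWhatWouldSuffice

/-! ### (g)–(h): the certificate shapes with the det-side link discharged

Dörfler–Ikenmeyer–Panova 2020 §5 run the two-sided comparison with EXPLICIT highest-weight vectors on
both sides; Ikenmeyer–Kandasamy 2020 Thm. 4.2 supplies per-side positivity by evaluation. In the tree
the per-side lower bound is a kernel-checked `TableauEval.Cert`; the det-side upper bound is either a
symmetric-Kronecker NUMBER (BLMW (5.2.7)) or a dimension count of exhibited det-ideal highest-weight
vectors (`PerDetMultiplicityObstructionAt.of_idealHwv`, rank–nullity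
`orbitMultiplicity_add_finrank_inf_eq_plethysmCoeff`). -/

/-- **(g) Certificate + symmetric-Kronecker number**: a kernel-verified canonical per-side certificate
`c` at `(c.n, c.m) = (3, 4)` whose recorded bound `c.sk` dominates `sk(λ, 4 × c.d)` closes the rung —
the det side is discharged by BLMW (5.2.7) inside `TableauEval.Cert.perDetSymKroneckerObstructionAt`
(`c.sk < c.r` is part of `c.verify`). OPEN: no such certificate is known (the cell's engines found
none in the window `d ≤ 12` at `(3, 4)` — a search record of the cell, not a theorem of this file).
[cite: BLMW2011, §5.2 (5.2.7)] -/
theorem multObstructionPer3Det4_of_cert_sk (c : TableauEval.Cert) [NeZero c.m]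
    (hn : c.n = 3) (hm : c.m = 4) (h : c.verify = true) (hcan : c.canonical = true)
    (hsk : symKroneckerCoeffRect ℂ c.m c.d
      (c.lamPartition (c.lam_pos_of_verify h) (c.lam_sum_of_verify h)) ≤ c.sk) :
    MultObstructionPer3Det4 :=
  multObstructionPer3Det4_of_at_eq hn hm
    (c.perDetSymKroneckerObstructionAt (K := ℂ) h hcan hsk).perDetMultiplicityObstructionAt

/-- **(h) Two-certificate shape (DIP 2020 §5 as run in print)**: a kernel-verified canonical per-side
certificate `c` at `(3, 4)` (`c.r ≤ mult_{λ*} ℂ[Δ(X₀₀ per₃)]_{c.d}`) together with `s` linearly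
independent highest-weight vectors of weight `λ*` in the ideal of `Δ(det₄)` and the count
`a_λ(d[16]) < c.r + s` closes the rung: rank–nullity gives `mult_{λ*} ℂ[Δ(det₄)] ≤ a_λ − s < c.r`.
Both data are OPEN at `(3, 4)`; the ideal binder `hI` is where det₄-equations (e.g. GCT II §6's
`Π_v` data, `MS08SecondFundamentalTheorem.lean`, up to the `toLex` renaming) would enter.
[cite: DorflerIkenmeyerPanova2020, §5 (5.3)–(5.4)] -/
theorem multObstructionPer3Det4_of_cert_idealHwv (c : TableauEval.Cert) [NeZero c.m]
    (hn : c.n = 3) (hm : c.m = 4) (h : c.verify = true) (hcan : c.canonical = true) {s : ℕ}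
    (F : Fin s → MvPolynomial (DegIdx (MatIdx c.m) c.m) ℂ)
    (hF : ∀ i, F i ∈ highestWeightSpace (coordRep (MatIdx c.m) ℂ c.m)
      (c.weight (c.lam_pos_of_verify h) (c.lam_sum_of_verify h)))
    (hI : ∀ i, F i ∈ orbitVanishingIdeal (detFormLex ℂ c.m) c.m) (hli : LinearIndependent ℂ F)
    (ha : plethysmCoeff ℂ (MatIdx c.m) c.m
      (c.weight (c.lam_pos_of_verify h) (c.lam_sum_of_verify h)) < c.r + s) :
    MultObstructionPer3Det4 := by
  have hS := c.spec_of_structural (c.structural_of_verify h)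
  have hlam : (c.lamPartition (c.lam_pos_of_verify h) (c.lam_sum_of_verify h)).parts.card ≤
      c.m * c.m := by
    rw [TableauEval.Cert.card_lamPartition]; exact hS.2.2.1
  exact multObstructionPer3Det4_of_at_eq hn hm
    (PerDetMultiplicityObstructionAt.of_idealHwv hS.2.1 hlam F hF hI hli ha
      (c.le_orbitMultiplicity (K := ℂ) h hcan))

/-! ### (n), (p): the corpus's own obstruction notions at the rung, padding discharged

BIP 2019 and IP 2017 pad the permanent with one of ITS OWN variables (`Z_{n,m} = Δ(X₁₁^{m-n} per_n)`,
tree `bipPaddedPerOrbitRep`); the rung pads with a FRESH variable (`Δ(X₀₀^{m-n} per_n)`,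
`paddedPerFormLex`). The tree proves `X₁₁^{m-n} per_n ∈ Δ(X₀₀^{m-n} per_n)` (BIP §1(a) remark,
`bipPaddedPerPoly_mem_orbitClosure_paddedPerPoly`), so per-side multiplicities only grow in the rung's
coordinates and the det side is common to both: every BIP/IP-form obstruction is a rung-form one. -/

/-- BIP's padded permanent lies in the orbit closure of the rung's padded permanent, in the `Lex`
coordinates of the rung (`rename toLex` of `bipPaddedPerPoly_mem_orbitClosure_paddedPerPoly`).
[cite: BurgisserIkenmeyerPanovaJAMS2019, §1(a) (the padding `Z_{n,m}`; §7 of IP 2017 compares the two)] -/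
theorem bipPaddedPerFormLex_mem_orbitClosure_paddedPerFormLex (n m : ℕ) [NeZero m] :
    bipPaddedPerFormLex ℂ n m ∈ orbitClosure (paddedPerFormLex ℂ n m) :=
  (rename_mem_orbitClosure_rename_iff_holds toLex (paddedPerPoly ℂ n m)
      (Literature.Computability.Complexity.bipPaddedPerPoly ℂ n m)).mpr
    (bipPaddedPerPoly_mem_orbitClosure_paddedPerPoly n m)

/-- **Padding monotonicity of multiplicities** (`n ≤ m`): `mult_χ ℂ[Z_{n,m}] ≤ mult_χ ℂ[Δ(X₀₀^{m-n} per_n)]`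
for every weight `χ`, by `Δ(X₁₁^{m-n} per_n) ⊆ Δ(X₀₀^{m-n} per_n)` and the monotonicity of orbit-closure
multiplicities under degeneration (`orbitMultiplicity_le_of_mem_orbitClosure_holds`).
[cite: BurgisserIkenmeyerPanovaJAMS2019, §1(a) and Lemma 2.2] -/
theorem orbitMultiplicity_bipPadded_le_padded {n m : ℕ} [NeZero m] (hnm : n ≤ m)
    (χ : Weight (MatIdx m)) :
    orbitMultiplicity ℂ (bipPaddedPerFormLex ℂ n m) m χ ≤
      orbitMultiplicity ℂ (paddedPerFormLex ℂ n m) m χ :=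
  orbitMultiplicity_le_of_mem_orbitClosure_holds _ _ (NeZero.ne m)
    (paddedPerFormLex_isHomogeneous ℂ hnm) (bipPaddedPerFormLex_isHomogeneous hnm)
    (bipPaddedPerFormLex_mem_orbitClosure_paddedPerFormLex n m) χ

/-- **(p), general `n ≤ m`: an occurrence obstruction in BIP's module language is a rung-form
multiplicity obstruction.** If the weight `χ` occurs in `ℂ[Z_{n,m}]` (`bipPaddedPerOrbitRep`) and does
NOT occur in `ℂ[Ω_m] = ℂ[Δ(det_m)]` (`detOrbitRep`), then `mult_χ ℂ[Δ(det_m)] = 0 < mult_χ ℂ[Δ(X₀₀^{m-n} per_n)]`.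
BIP Thm. 1.4 says such `χ` do not exist for `m ≥ n^25`; nothing is asserted about their existence here.
[cite: BurgisserIkenmeyerPanovaJAMS2019, Thm. 1.4 and §1(a)] -/
theorem perDetMultiplicityObstruction_of_bipOccurrence {n m : ℕ} [NeZero m] (hnm : n ≤ m)
    {χ : Weight (MatIdx m)} (hocc : HasHighestWeight (bipPaddedPerOrbitRep ℂ n m) χ)
    (hdet : ¬ HasHighestWeight (detOrbitRep ℂ m) χ) :
    PerDetMultiplicityObstruction (k := ℂ) n m χ := by
  refine perDetMultiplicityObstruction_iff.mpr ⟨hnm, ?_⟩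
  have hbip : 0 < orbitMultiplicity ℂ (bipPaddedPerFormLex ℂ n m) m χ :=
    (orbitMultiplicity_pos_iff_hasHighestWeight (bipPaddedPerFormLex ℂ n m) (NeZero.ne m) χ).2 hocc
  have hd : orbitMultiplicity ℂ (detFormLex ℂ m) m χ = 0 := by
    by_contra hne
    exact hdet ((orbitMultiplicity_pos_iff_hasHighestWeight (detFormLex ℂ m) (NeZero.ne m) χ).1
      (Nat.pos_of_ne_zero hne))
  have hle := orbitMultiplicity_bipPadded_le_padded hnm χ
  omega

/-- **(n), general `n ≤ m`: an IP (1.5) Kronecker-vanishing occurrence obstruction is a rung-form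
multiplicity obstruction** at the weight `λ*`: `g(λ, m×d, m×d) = 0` kills the det side
(`orbitMultiplicity_det_le_kroneckerCoeff_holds`, BLMW (5.2.7) with `sk ≤ g`), occurrence in
`ℂ[Z_{n,m}]` and padding monotonicity give the per side. IP's Main Theorem (printed Thm. 1.6) refutes the
hypothesis for `m > 3n⁴` (`not_kroneckerVanishingObstructionAt`); below that threshold it is open.
[cite: IkenmeyerPanova2017, §1(a) (1.5) with printed Thm. 1.4] -/
theorem exists_perDetMultiplicityObstruction_of_kroneckerVanishing {n m d : ℕ} [NeZero m]
    (hnm : n ≤ m) (h : KroneckerVanishingObstructionAt n m d) :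
    ∃ χ : Weight (MatIdx m), PerDetMultiplicityObstruction (k := ℂ) n m χ := by
  obtain ⟨lam, hlam, hocc, hg⟩ := h
  refine ⟨partitionWeightLex m lam, perDetMultiplicityObstruction_iff.mpr ⟨hnm, ?_⟩⟩
  have hdet : orbitMultiplicity ℂ (detFormLex ℂ m) m (partitionWeightLex m lam) = 0 := by
    have := orbitMultiplicity_det_le_kroneckerCoeff_holds (k := ℂ) lam hlam
    rw [hg] at this
    exact Nat.le_zero.mp this
  have hbip : 0 < orbitMultiplicity ℂ (bipPaddedPerFormLex ℂ n m) m (partitionWeightLex m lam) :=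
    (orbitMultiplicity_pos_iff_hasHighestWeight (bipPaddedPerFormLex ℂ n m) (NeZero.ne m) _).2 hocc
  have hle := orbitMultiplicity_bipPadded_le_padded hnm (partitionWeightLex m lam)
  omega

/-- **(n) at the rung**: an IP (1.5) Kronecker-vanishing occurrence obstruction at `(per₃, det₄)` (IP's
= BIP's padding) in any degree closes `MultObstructionPer3Det4`. OPEN hypothesis; `(3, 4)` is below
IP's threshold `3·3⁴ = 243` (`kroneckerVanishing_not_excluded_at_rung`), so nothing printed excludes it,
and nothing here suggests it holds. [cite: IkenmeyerPanova2017, §1(a) (1.5)] -/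
theorem multObstructionPer3Det4_of_kroneckerVanishing {d : ℕ}
    (h : KroneckerVanishingObstructionAt 3 4 d) : MultObstructionPer3Det4 :=
  exists_perDetMultiplicityObstruction_of_kroneckerVanishing (by norm_num) h

/-- **(n′) at the rung, fresh padding**: the same with the rung's own padding
(`FreshKroneckerVanishingObstructionAt`, = a `PerDetKroneckerObstructionAt` with `g = 0` by
`freshKroneckerVanishingObstructionAt_iff_exists_perDetKroneckerObstructionAt`), through link (b).
OPEN hypothesis. [cite: IkenmeyerPanova2017, §1(a) (1.5) and §7 (the two paddings)] -/
theorem multObstructionPer3Det4_of_freshKroneckerVanishing {d : ℕ}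
    (h : FreshKroneckerVanishingObstructionAt 3 4 d) : MultObstructionPer3Det4 := by
  obtain ⟨lam, hK, -⟩ :=
    (freshKroneckerVanishingObstructionAt_iff_exists_perDetKroneckerObstructionAt (by norm_num)).mp h
  exact multObstructionPer3Det4_of_kronecker hK

/-- **(p) at the rung**: a weight occurring in `ℂ[Z_{3,4}]` (BIP's module language) and not in
`ℂ[Δ(det₄)]` closes `MultObstructionPer3Det4`. OPEN hypothesis (an OCCURRENCE obstruction at `(3, 4)`;
`4 < 3^25`, `multObstructionPer3Det4_outside_bip_range`, so BIP Thm. 1.4 is silent here).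
[cite: BurgisserIkenmeyerPanovaJAMS2019, Thm. 1.4 and §1(a)] -/
theorem multObstructionPer3Det4_of_bipOccurrence {χ : Weight (MatIdx 4)}
    (hocc : HasHighestWeight (bipPaddedPerOrbitRep ℂ 3 4) χ)
    (hdet : ¬ HasHighestWeight (detOrbitRep ℂ 4) χ) : MultObstructionPer3Det4 :=
  ⟨χ, perDetMultiplicityObstruction_of_bipOccurrence (by norm_num) hocc hdet⟩

/-- Bookkeeping: `(per₃, det₄)` is below Ikenmeyer–Panova's threshold `m > 3n⁴` (`4 ≤ 243`), so their
Main Theorem (printed Thm. 1.6, `not_kroneckerVanishingObstructionAt`) does not exclude link (n) at the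
rung; it refutes only the FAMILY/range versions (`not_kroneckerVanishingRouteQP`,
`not_kroneckerVanishingObstructionsAtPower`, `c ≥ 5`). [cite: IkenmeyerPanova2017, Thm. 1.6 (printed)] -/
theorem kroneckerVanishing_not_excluded_at_rung : ¬ (3 * 3 ^ 4 < 4) := by norm_num

/-! ### (m): GCT II's strong obstruction gives the separation, not (yet) the rung -/

/-- **(m) A strong obstruction (Mulmuley–Sohoni GCT II, Def. 1.3) for `(X₀₀ per₃, det₄)` with `G = GL₁₆`
proves `X₀₀ per₃ ∉ Δ(det₄)`** (`¬ HasBorderDetRepr ℂ 3 4`) through Thm. 1.8(a)'s mechanism as typed in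
`MS08Obstructions.lean` (`HasStrongObstruction.not_mem_orbitClosure`; `det₄ ≠ 0`, full projective
orbit for `G = ⊤`, both forms homogeneous of degree `4`). This is the SEPARATION the rung validates
against (known: `dc̄(per₃) = 5`); the rung's weight-form statement follows too, see (m⁗) below
(appended once the intertwiner→weight bridge landed). OPEN hypothesis; no strong obstruction is known
at `(3, 4)`. [cite: MulmuleySohoniGCT2SIAM2008, Def. 1.3, Thm. 1.8(a)] -/
theorem not_hasBorderDetRepr_three_four_of_strongObstruction {d : ℕ}
    (h : HasStrongObstruction (⊤ : Subgroup (GL (Fin 4 × Fin 4) ℂ)) (detPoly (Fin 4) ℂ)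
      (paddedPerPoly ℂ 3 4) 4 d) :
    ¬ HasBorderDetRepr ℂ 3 4 :=
  h.not_mem_orbitClosure (Matrix.det_mvPolynomialX_ne_zero (Fin 4) ℂ) (hasFullProjectiveOrbit_top _)
    (by simpa using (detPoly_isHomogeneous (n := Fin 4) (k := ℂ)))
    (paddedPerPoly_isHomogeneous (k := ℂ) (by norm_num))

/-! ### (m″)–(m⁗): APPEND — with the intertwiner→weight bridge, module-form obstructions reach the rung

Appended after `Literature/Computability/AlgebraicComplexity/OccurrenceObstructionWeights.lean` landed
(`exists_isOccurrenceObstructionAt_of_hasOccurrenceObstruction`: in characteristic zero, for `m ≠ 0`, a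
module-form occurrence obstruction in some degree yields a weight `χ` with
`mult_χ ℂ[Δ_m[f]] = 0 < mult_χ ℂ[Δ_m[g]]`; its ingredients `not_hasOccurrenceObstruction_of_forall_hasHighestWeight`
(`GCTObstructionsWeightForm.lean`) and `orbitMultiplicity_pos_iff_hasHighestWeight`
(`OrbitMultiplicitySemigroup.lean`) are what (m″) uses, so that this file's imports stay inside the
long-built part of the tree). An occurrence obstruction is in particular a multiplicity
obstruction `0 = mult_χ ℂ[Δ(det₄)] < mult_χ ℂ[Δ(X₀₀ per₃)]`, i.e. a rung witness. By Bürgisser–Ikenmeyer–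
Panova 2019 Thm. 1.4 such `χ` do NOT exist for `m ≥ n^25` (tree: `bip2019_not_hasOccurrenceObstruction_holds`);
`(3, 4)` is outside that range (part 1, `multObstructionPer3Det4_outside_bip_range`), so at the rung the
hypothesis is OPEN, neither known nor excluded. Nothing here is evidence that it holds. -/

/-- **(m″) A module-form occurrence obstruction for `(X₀₀ per₃, det₄)` in any degree `d` gives the rung.**
`HasOccurrenceObstruction (det₄) (X₀₀ per₃) 4 d` (some irreducible `W ≤ ℂ[Δ_4[X₀₀ per₃]]_d` with no nonzero
intertwiner to `ℂ[Δ_4[det₄]]_d`, GCT II §1 / BIP §1(a) "occurs in `ℂ[Z]_d` but not in `ℂ[Ω]_d`") ⟹ some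
`χ` with `mult_χ(det₄) = 0 < mult_χ(X₀₀ per₃)` (the bridge: in general
`exists_isOccurrenceObstructionAt_of_hasOccurrenceObstruction`, `OccurrenceObstructionWeights.lean`; here
its two ingredients `not_hasOccurrenceObstruction_of_forall_hasHighestWeight` (Lie–Kolchin + theorem of
the highest weight) and `orbitMultiplicity_pos_iff_hasHighestWeight` are applied directly) ⟹
`∃ χ, mult_χ(det₄) < mult_χ(X₀₀ per₃)` (`multObstructionPer3Det4_iff`). OPEN hypothesis at `(3, 4)`.
[cite: BurgisserIkenmeyerPanovaJAMS2019, §1(a) (occurrence obstructions; Schur's lemma)] -/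
theorem multObstructionPer3Det4_of_hasOccurrenceObstruction {d : ℕ}
    (h : HasOccurrenceObstruction (detFormLex ℂ 4) (paddedPerFormLex ℂ 3 4) 4 d) :
    MultObstructionPer3Det4 := by
  -- the bridge `exists_isOccurrenceObstructionAt_of_hasOccurrenceObstruction`
  -- (`OccurrenceObstructionWeights.lean`), inlined at `(3, 4)` over its two tree ingredients
  by_contra hne
  refine not_hasOccurrenceObstruction_of_forall_hasHighestWeight (by norm_num) (fun χ hχ => ?_) d h
  by_contra hdet
  refine hne (multObstructionPer3Det4_iff.mpr ⟨χ, ?_⟩)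
  have hper : 0 < orbitMultiplicity ℂ (paddedPerFormLex ℂ 3 4) 4 χ :=
    (orbitMultiplicity_pos_iff_hasHighestWeight _ (by norm_num) χ).mpr hχ
  have hdet0 : ¬ 0 < orbitMultiplicity ℂ (detFormLex ℂ 4) 4 χ := fun h0 =>
    hdet ((orbitMultiplicity_pos_iff_hasHighestWeight _ (by norm_num) χ).mp h0)
  omega

/-- **(m‴) A STRONG obstruction (Mulmuley–Sohoni GCT II, Def. 1.3) for `(X₀₀ per₃, det₄)` with `G = GL₁₆`,
in the lexicographic matrix variables, gives the rung**: strong ⟹ occurrence obstruction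
(`HasStrongObstruction.hasOccurrenceObstruction`, GCT II §1 after Def. 1.3 with Prop. 4.2; `det₄ ≠ 0`,
full projective orbit for `G = ⊤`) ⟹ (m″). OPEN hypothesis; no strong obstruction is known at `(3, 4)`.
[cite: MulmuleySohoniGCT2SIAM2008, Def. 1.3, §1 (a strong obstruction is an obstruction)] -/
theorem multObstructionPer3Det4_of_strongObstruction {d : ℕ}
    (h : HasStrongObstruction (⊤ : Subgroup (GL (MatIdx 4) ℂ)) (detFormLex ℂ 4)
      (paddedPerFormLex ℂ 3 4) 4 d) :
    MultObstructionPer3Det4 :=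
  multObstructionPer3Det4_of_hasOccurrenceObstruction
    (h.hasOccurrenceObstruction (Literature.Computability.Complexity.detFormLex_ne_zero (k := ℂ) 4)
      (hasFullProjectiveOrbit_top _))

/-- **(m⁗) The hypothesis of (m) verbatim — a strong obstruction for `(X₀₀ per₃, det₄)` in G20's matrix
variables `Fin 4 × Fin 4` (`detPoly`, `paddedPerPoly`) — gives the rung**, not only the separation of (m):
strong ⟹ occurrence obstruction (GCT II) ⟹ transport along `toLex` to the lexicographic forms
`detFormLex ℂ 4 = rename toLex det₄`, `paddedPerFormLex ℂ 3 4 = rename toLex (X₀₀ per₃)`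
(`hasOccurrenceObstruction_rename_toLex_iff`, `toLex` is the identity) ⟹ (m″). OPEN hypothesis.
[cite: MulmuleySohoniGCT2SIAM2008, Def. 1.3, Thm. 1.8(a)] -/
theorem multObstructionPer3Det4_of_strongObstruction_matrix {d : ℕ}
    (h : HasStrongObstruction (⊤ : Subgroup (GL (Fin 4 × Fin 4) ℂ)) (detPoly (Fin 4) ℂ)
      (paddedPerPoly ℂ 3 4) 4 d) :
    MultObstructionPer3Det4 :=
  multObstructionPer3Det4_of_hasOccurrenceObstruction
    ((Literature.Computability.Complexity.hasOccurrenceObstruction_rename_toLex_iff _ _ 4 d).mpr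
      (h.hasOccurrenceObstruction (Matrix.det_mvPolynomialX_ne_zero (Fin 4) ℂ)
        (hasFullProjectiveOrbit_top _)))

/-! ### (q)–(q′): APPEND — the Dörfler–Ikenmeyer–Panova set form of a multiplicity obstruction is the rung

Dörfler–Ikenmeyer–Panova 2020 §2 (2.2) states multiplicity obstructions for a pair of `GL`-stable SETS
`Z_f ⊄ Z_g` via `mult_λ ℂ[Z_g] < mult_λ ℂ[Z_f]`; the typed section `DIP20MultiplicityObstructions.lean`
(typer t07) carries `coordRingMultiplicity k Z n χ` and the PROVED identification
`coordRingMultiplicity_eq_orbitMultiplicity`: for `n ≠ 0` and any `Z` with `GL·f ⊆ Z ⊆ End·f` the set-form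
multiplicity is the rung's `orbitMultiplicity k f n χ` (all three sets have the same vanishing ideal). So
at `(3, 4)` the set-form strict inequality for (anything sandwiching) the orbits of `det₄` and `X₀₀ per₃`
IS the rung. OPEN hypothesis (it is the rung, reworded); nothing here is evidence for it. -/

/-- **(q) DIP set form ⇒ rung**: for any `Zdet`, `Zper` sandwiched between the `GL`- and `End`-orbits of
`det₄` resp. `X₀₀ per₃` (e.g. the orbits themselves, or the orbit closures), a weight `χ` with
`mult_χ ℂ[Zdet] < mult_χ ℂ[Zper]` (`coordRingMultiplicity`, DIP (2.2)) gives `MultObstructionPer3Det4`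
(`coordRingMultiplicity_eq_orbitMultiplicity` twice, then `multObstructionPer3Det4_iff`).
[cite: DorflerIkenmeyerPanova2020, §2 eq. (2.2)] -/
theorem multObstructionPer3Det4_of_coordRingMultiplicity_lt
    {Zdet Zper : Set (MvPolynomial (MatIdx 4) ℂ)}
    (hd₁ : glOrbit (MatIdx 4) ℂ (detFormLex ℂ 4) ⊆ Zdet)
    (hd₂ : Zdet ⊆ endOrbit (MatIdx 4) ℂ (detFormLex ℂ 4))
    (hp₁ : glOrbit (MatIdx 4) ℂ (paddedPerFormLex ℂ 3 4) ⊆ Zper)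
    (hp₂ : Zper ⊆ endOrbit (MatIdx 4) ℂ (paddedPerFormLex ℂ 3 4)) (χ : Weight (MatIdx 4))
    (h : coordRingMultiplicity ℂ Zdet 4 χ < coordRingMultiplicity ℂ Zper 4 χ) :
    MultObstructionPer3Det4 := by
  rw [coordRingMultiplicity_eq_orbitMultiplicity (by norm_num) hd₁ hd₂,
    coordRingMultiplicity_eq_orbitMultiplicity (by norm_num) hp₁ hp₂] at h
  exact multObstructionPer3Det4_iff.mpr ⟨χ, h⟩

/-- **(q′) the literal orbit instance of (q)** (`Z = GL·f` on both sides, no sandwich binders): a strict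
inequality of DIP set-form multiplicities between the `GL₁₆`-orbits of `det₄` and of `X₀₀ per₃` at some
weight is the rung. [cite: DorflerIkenmeyerPanova2020, §2 eq. (2.2)] -/
theorem multObstructionPer3Det4_of_coordRingMultiplicity_glOrbit_lt (χ : Weight (MatIdx 4))
    (h : coordRingMultiplicity ℂ (glOrbit (MatIdx 4) ℂ (detFormLex ℂ 4)) 4 χ <
      coordRingMultiplicity ℂ (glOrbit (MatIdx 4) ℂ (paddedPerFormLex ℂ 3 4)) 4 χ) :
    MultObstructionPer3Det4 :=
  multObstructionPer3Det4_of_coordRingMultiplicity_lt subset_rfl (glOrbit_subset_endOrbit _)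
    subset_rfl (glOrbit_subset_endOrbit _) χ h

end Summit.ValiantsHypothesis.BIPWhatWouldSufficeTyped
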